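import Literature.IUT.HodgeArakelov.MonoThetaFromGroupsProofs
import Literature.IUT.HodgeArakelov.ModelDef11Output
import Literature.AnabelianGeometry.EtaleTheta.Discharge.Sec2DtpYThetaAbelianCorollaries

/-!
# [IUTchII] §1, Proposition 1.2 (i): the indeterminacy clause for the CHOSEN outputs `M^Θ(Π)` of bridge B8
# part 6 — over an [EtTh] rigidity interface, and for the Tate curve of an [EtTh] §1 theta setting

Mochizuki, *Inter-universal Teichmüller theory II*, §1, Proposition 1.2 (i) (kurims p. 25) [claim: Mochizuki2012,
status: disputed] (IUTchII §1 Prop 1.2 (i), kurims p.25). DAG node `IUTchII:Prop1.2(i)` (abc-iut cell, cone of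
[IUTchIII] Cor. 3.12; seat abc-iut-w4-d008). PROOF-ONLY companion (no `def`, no new named fact) of
`MonoThetaFromGroups.lean` (abc-iut-L6-t1), continuing `MonoThetaFromGroupsProofs.lean` (same seat) and
abc-iut-L6-d6's `ModelDef11Output.lean` (bridge B8 part 6: the Prop. 1.2 (i) OUTPUT `ThetaSetting.envOfGroup`
for the [IUTchII] §1 setting built from `R : RigidData N l`, and its Tate-curve instance).

* `prop12_i_indeterminacy_of_ker_eq_centralizerUnion` — the INTRINSIC form of the hypothesis of
  `prop12_i_indeterminacy_of_modelIso`: it suffices that the output's `Π_M ↠ Π_Y(M)` be the group-theoretic quotient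
  of [EtTh] Cor. 2.18 (iii) (kernel = `centralizerUnion`), modulo the named fact `ThetaEnvData.Cor218_iii_quotient`.
* `prop12_i_indeterminacy_transport` / `prop12_i_indeterminacy_def11OutputOfFrame` — stability of the kernel
  hypothesis under `Reconstruction.transport`; hence the clause for d6's Def. 1.1 output of EVERY `M`
  (`ModelFrame.def11OutputOfFrame`).
* `exists_envOfFrobenioid_of_isMonoThetaEnv` / `exists_envOfGroup_of_isMonoThetaEnv` — the Prop. 1.2 (ii) / (i)
  OUTPUTS with `M^Θ(−)` UNDERLAIN BY A GIVEN [EtTh] mono-theta environment `M'` (e.g. abc-iut-L2-t4's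
  Frobenioid-theoretic `ThetaFrobenioid.frdMonoThetaEnv`, [EtTh] Lemma 5.9 (iv) / Thm. 5.10), via bridge B8's
  `MonoThetaEnv.ofIsMonoThetaEnv` (modulo the named fact `ThetaEnvData.Cor218_ii`), with the indeterminacy clause.
* `ThetaSetting.prop12_i_indeterminacy_envOfGroup` — for d6's CHOSEN `M^Θ(Π)` (the [EtTh] model re-bundled, with
  the Def. 1.1 (i) output of bridge B8 part 5b at the identity frame) the isomorphism-indeterminacy clause
  `Prop12_i_indeterminacy` HOLDS, modulo the named [EtTh] fact `RigidData.Cor218_iv_fibre` (Cor. 2.18 (iv)):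
  "a group of `μ_N`-conjugacy classes of automorphisms which is of order `1` (resp. `2`) if `N` is odd (resp.
  even)". The identification `M^Θ(Π) ≅ model` is the IDENTITY map (`D_Π`: `Out → Aut → Out` is the identity,
  `autToOut_outToAut`).
* `ThetaSetting.prop12_i_indeterminacy_envOfGroup_ofDoubleUnderline` — **the same for the Tate curve `X̲̲_K` of an
  [EtTh] §1 theta setting** (L2-t8's `DoubleUnderline.rigidData`, the [IUTchII] §1 setting `ofDoubleUnderline` of
  bridge B8 part 3), where Cor. 2.18 (iv) (fibres) is NOT assumed: it is L2's PROVED chain Prop. 2.14 (i)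
  (`rigidData_prop214_i`, abc-iut-L2-t8/t10 + abc-iut-L4-d2's `galoisMLF_slim_holds`) ⟹ Cor. 2.18 (iv) fibres
  (`cor218_iv_fibre_of_prop214_i`; with "(Δ^tp_Y)^Θ abelian" itself PROVED, abc-iut-L2-t8's
  `rigidData_cor218_iv_fibre_of_origin`). Remaining hypotheses, all NAMED L2 inputs of those files:
  `Prop15iii` ([EtTh] Prop. 1.5 (iii)), the vacuity guard `IsEtThOrigin`, the p. 12–13 hypothesis `hYcl`
  ("(Δ^tp_Y)^Θ is profinite"), and "`(l·Δ_Θ)/thetaKer ≅ Ẑ`" (`hZ`, [EtTh] §1 p. 12), plus the printed side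
  conditions of [IUTchII] §1 p. 20 (`l` prime, `p ≠ 2`, `p ≠ l`, `ζ_{4l} ∈ K`);
  `ThetaSetting.exists_envOfFrobenioid_indeterminacy_ofDoubleUnderline` — Prop. 1.2 (ii) at the Tate curve likewise.

HONEST FRAMING: kernel-checked implications between typed statements; nothing here asserts a disputed claim or
takes a side on [IUTchIII] Cor. 3.12; typed ≠ discharged elsewhere. [cite: MochizukiEtTh2009, Cor 2.18(iv) p.61]
-/

noncomputable section

namespace Literature.IUT.HodgeArakelov

universe u

open Literature.AnabelianGeometry.EtaleTheta Literature.AnabelianGeometry.SemiGraphs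
open scoped Literature.AnabelianGeometry.EtaleTheta

/-! ## Intrinsic form of the kernel hypothesis: the group-theoretic quotient of [EtTh] Cor. 2.18 (iii) -/

section Intrinsic

variable {S : ThetaSetting.{u}} {T : ThetaEnvData.{u} S.N} {η : T.PiYdd → T.mu} {hη : η ∈ T.thetaCocycles}
  {M : MonoThetaEnv S}

/-- **[IUTchII] Prop. 1.2 (i), indeterminacy clause — intrinsic form.** For a Def. 1.1 (i) output `R` of `M` whose
quotient `Π_M ↠ Π_Y(M)` IS the group-theoretic one of [EtTh] Cor. 2.18 (iii) — kernel = the union of the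
centralisers of the open subgroups of `Π_M` (`centralizerUnion`, the printed recipe "[cf. [EtTh], Corollary 2.18,
(iii)]" of Def. 1.1 (i)) — the automorphisms of `M` over `Π_Y(M)` form `1` resp. `2` `μ_N`-conjugacy classes,
modulo the named [EtTh] facts `ThetaEnvData.Cor218_iii_quotient` (Cor. 2.18 (iii) for the model) and
`ThetaEnvData.Cor218_iv_fibre` (Cor. 2.18 (iv)), `M` being identified with the model by `ε` (bridge B8).
[claim: Mochizuki2012, status: disputed] (IUTchII §1 Prop 1.2 (i), kurims p.25) -/
theorem prop12_i_indeterminacy_of_ker_eq_centralizerUnion (Rc : Reconstruction M)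
    (haug : Function.Surjective (T.aug.comp T.PiYdd.subtype)) (hfib : T.Cor218_iv_fibre)
    (hq : T.Cor218_iii_quotient) (ε : M.toEtale.Iso (T.modelMono hη))
    (hker : ∀ x : M.Pi, Rc.projY x = 1 ↔ x ∈ centralizerUnion M.Pi) : Prop12_i_indeterminacy Rc := by
  refine prop12_i_indeterminacy_of_modelIso Rc haug hfib ε fun x => (hker x).trans ?_
  have hcu : (centralizerUnion M.Pi).map ε.e.toMulEquiv.toMonoidHom = (CycEnvelope.proj T.augY T.chi).ker := by
    rw [← show centralizerUnion T.env = (CycEnvelope.proj T.augY T.chi).ker from hq]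
    exact map_centralizerUnion_eq ε.e
  rw [← MonoidHom.mem_ker, ← hcu]
  constructor
  · exact fun hx => Subgroup.mem_map.mpr ⟨x, hx, rfl⟩
  · intro h
    obtain ⟨y, hy, hxy⟩ := Subgroup.mem_map.mp h
    exact ε.e.injective hxy ▸ hy

/-- **Stability under transport** ("functorial algorithm"): if a Def. 1.1 (i) output `R` of `M` has the model's
`Π_Y`-kernel (read through `ε`), so does its transport along any isomorphism `α : M ≅ M'` of mono-theta
environments (read through `α⁻¹ ≫ ε`); hence the indeterminacy clause holds for `R.transport α`
(abc-iut-L6-d6's `Reconstruction.transport`, bridge B8 part 4).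
[claim: Mochizuki2012, status: disputed] (IUTchII §1 Prop 1.2 (i), kurims p.25) -/
theorem prop12_i_indeterminacy_transport {M' : MonoThetaEnv S} (Rc : Reconstruction M)
    (haug : Function.Surjective (T.aug.comp T.PiYdd.subtype)) (hfib : T.Cor218_iv_fibre)
    (ε : M.toEtale.Iso (T.modelMono hη))
    (hker : ∀ x : M.Pi, Rc.projY x = 1 ↔ CycEnvelope.proj T.augY T.chi (ε.e x) = 1)
    (α : MonoThetaEnv.Iso M M') : Prop12_i_indeterminacy (Rc.transport α) :=
  prop12_i_indeterminacy_of_modelIso (Rc.transport α) haug hfib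
    (MonoThetaBridge.etaleIsoTrans α.symm.toEtale ε) (fun x => hker (α.iso.symm x))

/-- **The indeterminacy clause for abc-iut-L6-d6's Def. 1.1 output of EVERY mono-theta environment of the
setting** (`ModelFrame.def11OutputOfFrame`, bridge B8 part 5b: the model's output transported along
`MonoThetaEnv.nonempty_iso`), modulo the named fact `RigidData.Cor218_iv_fibre`.
[claim: Mochizuki2012, status: disputed] (IUTchII §1 Prop 1.2 (i), kurims p.25) -/
theorem prop12_i_indeterminacy_def11OutputOfFrame {l : ℕ} {R : RigidData.{u} S.N l} (F : ModelFrame S R)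
    (hfib : R.Cor218_iv_fibre) {η₀ : R.PiYdd → R.mu} (hη₀ : η₀ ∈ R.thetaCocycles) {M₀ : MonoThetaEnv S}
    (ε₀ : M₀.toEtale.Iso (R.modelMono hη₀)) (M' : MonoThetaEnv S) :
    Prop12_i_indeterminacy (F.def11OutputOfFrame ε₀.e M').recon :=
  prop12_i_indeterminacy_transport (F.reconstruction ε₀.e) R.augYdd_surjective
    ((RigidData.cor218_iv_fibre_iff R).mp hfib) ε₀ (fun _ => Iff.rfl) _

end Intrinsic

/-! ## Prop. 1.2 (ii) with `M^Θ(𝒞)` underlain by a GIVEN [EtTh] mono-theta environment -/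

section Frobenioid

variable {S : ThetaSetting.{u}} {l : ℕ} {R : RigidData.{u} S.N l}

/-- **[IUTchII] Prop. 1.2 (ii) with `M^Θ(𝒞)` UNDERLAIN BY A GIVEN [EtTh] mono-theta environment** — e.g.
abc-iut-L2-t4's Frobenioid-theoretic `ThetaFrobenioid.frdMonoThetaEnv` (`E^Π_N`, [EtTh] Lemma 5.9 (iv) "in
particular … a mod `N` mono-theta environment", their `FrdIsMonoThetaEnv`), which is how print constructs
`M^Θ(𝒞)` ([EtTh] Thm. 5.10 (iii)): for any [EtTh] datum `M'` which IS a mono-theta environment of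
`R.toThetaEnvData` there is, for every instance `Fr` of the typer's `TemperedFrobenioidData S`, an
`EnvOfFrobenioid Fr` whose `M^Θ(𝒞)` has underlying [EtTh] datum EXACTLY `M'` (bridge B8 `ofIsMonoThetaEnv`,
modulo the named fact [EtTh] Cor. 2.18 (ii) `ThetaEnvData.Cor218_ii`) and whose Def. 1.1 (i) output has the
Prop. 1.2 (i) isomorphism indeterminacy (modulo `RigidData.Cor218_iv_fibre`).
[claim: Mochizuki2012, status: disputed] (IUTchII §1 Prop 1.2 (ii), kurims pp.25-26) -/
theorem exists_envOfFrobenioid_of_isMonoThetaEnv (F : ModelFrame S R) (A : ModelAgreement S R.toThetaEnvData)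
    (h218ii : R.toThetaEnvData.Cor218_ii) (hfib : R.Cor218_iv_fibre)
    (M' : Literature.AnabelianGeometry.EtaleTheta.MonoThetaEnv.{u}) (hM' : R.toThetaEnvData.IsMonoThetaEnv M')
    (Fr : TemperedFrobenioidData S) :
    ∃ E : EnvOfFrobenioid Fr, E.env.toEtale = M' ∧ Prop12_i_indeterminacy E.recon := by
  obtain ⟨α⟩ := (MonoThetaEnv.ofIsMonoThetaEnv h218ii A M' hM').nonempty_toEtale_iso_modelEnv
  exact ⟨⟨MonoThetaEnv.ofIsMonoThetaEnv h218ii A M' hM', F.reconstruction (MonoThetaBridge.etaleIsoTrans α A.iso).e,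
      Fr.baseEquiv.trans (Fr.Btemp0_map F.eX.symm)⟩,
    MonoThetaEnv.toEtale_ofEtale M' (nonempty_iso_modelEnv_of_isMonoThetaEnv h218ii A M' hM'),
    prop12_i_indeterminacy_reconstruction F hfib A.mem (MonoThetaBridge.etaleIsoTrans α A.iso)⟩

/-- The same for the Prop. 1.2 (i) output: `M^Θ(Π)` may be taken UNDERLAIN BY ANY GIVEN [EtTh] mono-theta
environment `M'` of `R.toThetaEnvData` (modulo `ThetaEnvData.Cor218_ii`), with the indeterminacy clause (modulo
`RigidData.Cor218_iv_fibre`). [claim: Mochizuki2012, status: disputed] (IUTchII §1 Prop 1.2 (i), kurims p.25) -/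
theorem exists_envOfGroup_of_isMonoThetaEnv (F : ModelFrame S R) (A : ModelAgreement S R.toThetaEnvData)
    (h218ii : R.toThetaEnvData.Cor218_ii) (hfib : R.Cor218_iv_fibre)
    (M' : Literature.AnabelianGeometry.EtaleTheta.MonoThetaEnv.{u}) (hM' : R.toThetaEnvData.IsMonoThetaEnv M')
    (P : TopGroup.{u}) (h : Nonempty (P ≃ₜ* S.PiX)) :
    ∃ E : EnvOfGroup S P, E.env.toEtale = M' ∧ Prop12_i_indeterminacy E.recon := by
  obtain ⟨α⟩ := (MonoThetaEnv.ofIsMonoThetaEnv h218ii A M' hM').nonempty_toEtale_iso_modelEnv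
  exact ⟨⟨h, MonoThetaEnv.ofIsMonoThetaEnv h218ii A M' hM',
      F.reconstruction (MonoThetaBridge.etaleIsoTrans α A.iso).e, h.some.trans F.eX.symm⟩,
    MonoThetaEnv.toEtale_ofEtale M' (nonempty_iso_modelEnv_of_isMonoThetaEnv h218ii A M' hM'),
    prop12_i_indeterminacy_reconstruction F hfib A.mem (MonoThetaBridge.etaleIsoTrans α A.iso)⟩

end Frobenioid

namespace ThetaSetting

/-! ## The setting built from `R : RigidData N l` -/

section OfRigidData

variable {N : ℕ+} {l : ℕ} (R : RigidData.{u} N l) [TopologicalSpace R.G] [IsTopologicalGroup R.G]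
  (X : SideData R.toThetaEnvData)

/-- **[IUTchII] Prop. 1.2 (i), indeterminacy clause, for bridge B8 part 6's chosen `M^Θ(Π)`** over the setting
built from `R` (modulo the named fact `RigidData.Cor218_iv_fibre`): the automorphisms of `M^Θ(Π)` acting trivially
on `Π_Y(M^Θ(Π)) = Π^tp_Y` form `1` (`N` odd) resp. `2` (`N` even) `μ_N`-conjugacy classes.
[claim: Mochizuki2012, status: disputed] (IUTchII §1 Prop 1.2 (i), kurims p.25) -/
theorem prop12_i_indeterminacy_envOfGroup (h1 : T1Space R.PiX)
    (h2 : IsClosed (((R.aug.ker : Subgroup R.PiX)) : Set R.PiX))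
    (h3 : Nonempty (ModelCyclotomes.lDeltaQuot R ≃* Literature.IUT.HodgeTheaters.ZHat))
    (P : TopGroup.{u}) (hP : Nonempty (P ≃ₜ* (ofThetaEnvData R.toThetaEnvData X).PiX))
    (hfib : R.Cor218_iv_fibre) :
    Prop12_i_indeterminacy (envOfGroup R X h1 h2 h3 P hP).recon := by
  refine prop12_i_indeterminacy_of_modelIso (T := R.toThetaEnvData) (hη := X.mem)
    (envOfGroup R X h1 h2 h3 P hP).recon R.augYdd_surjective ((RigidData.cor218_iv_fibre_iff R).mp hfib)
    { e := ContinuousMulEquiv.refl _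
      map_D := ?_
      map_sTheta := ?_ } (fun _ => Iff.rfl)
  · -- `D_Π`: read `D_Y` into `Aut` and back (`autToOut_outToAut`), transported along the identity
    change (autToOut R.env (outToAut R.env R.DY)).map (TopOut.transport (ContinuousMulEquiv.refl R.env)) = R.DY
    rw [TopOut.transport_refl, Subgroup.map_id, autToOut_outToAut]
  · -- `s^Θ_Π`: the class itself, transported along the identity
    change (fun H : Subgroup R.env => H.map (ContinuousMulEquiv.refl R.env).toMulEquiv.toMonoidHom) ''
        CycEnvelope.muConjClass R.augY R.chi (R.sTheta X.mem).range =
      CycEnvelope.muConjClass R.augY R.chi (R.sTheta X.mem).range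
    have hid : (fun H : Subgroup R.env => H.map (ContinuousMulEquiv.refl R.env).toMulEquiv.toMonoidHom) = id :=
      funext fun H => Subgroup.map_id H
    rw [hid, Set.image_id]

end OfRigidData

/-! ## The Tate curve of an [EtTh] §1 theta setting -/

section Tate

variable {p : ℕ} [Fact p.Prime] {D : Literature.AnabelianGeometry.EtaleTheta.ThetaSetting p}
  {E : D.EtaleThetaData} {l : ℕ} (C : E.DoubleUnderline l) {N : ℕ+} (μ : D.CyclotomeMod l N)
  (hC : D.Compat) (hS : D.Sec2Hyps)

/-- **[IUTchII] Prop. 1.2 (i) for the Tate curve `X̲̲_K` of an [EtTh] §1 theta setting**: for every topological group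
`Π ≅ Π^tp_{X̲̲_K}`, bridge B8 part 6's chosen `M^Θ(Π)` over the [IUTchII] §1 setting `ofDoubleUnderline` has the
printed isomorphism indeterminacy — `1` (`N` odd) resp. `2` (`N` even) `μ_N`-conjugacy classes of automorphisms
over `Π_Y` — with [EtTh] Cor. 2.18 (iv) NOT assumed but supplied by L2's proved Prop. 2.14 (i) ⟹ Cor. 2.18 (iv)
(fibres) (`rigidData_cor218_iv_fibre_of_origin`). Conditional exactly on the named L2 inputs `Prop15iii`,
`IsEtThOrigin`, `hYcl`, `hZ` and the printed side conditions of [IUTchII] §1 p. 20. [claim: Mochizuki2012, status: disputed] (IUTchII §1 Prop 1.2 (i), kurims p.25) -/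
theorem prop12_i_indeterminacy_envOfGroup_ofDoubleUnderline
    (h15 : Literature.AnabelianGeometry.EtaleTheta.ThetaSetting.Prop15iii E hC) (L : C.CuspLabels)
    (hl : l.Prime) (hp2 : p ≠ 2) (hpl : p ≠ l) (hζ : ∃ ζ : D.K, IsPrimitiveRoot ζ (4 * l))
    {η : (C.thetaEnvData μ hC hS).PiYdd → MuN p N} (hη : η ∈ (C.thetaEnvData μ hC hS).thetaCocycles)
    (hZ : Nonempty (ModelCyclotomes.lDeltaQuot (C.rigidData μ hC hS h15 L) ≃* Literature.IUT.HodgeTheaters.ZHat))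
    (hO : D.IsEtThOrigin)
    (hYcl : (D.DtpY.map D.toHat.toMonoidHom).topologicalClosure ≤
      D.DtpY.map D.toHat.toMonoidHom ⊔ (⁅⁅D.DeltaHat, D.DeltaHat⁆, D.DeltaHat⁆).topologicalClosure)
    (P : TopGroup.{0}) (hP : Nonempty (P ≃ₜ* (ofDoubleUnderline C μ hC hS hl hp2 hpl hζ hη).PiX)) :
    Prop12_i_indeterminacy
      (envOfGroup (C.rigidData μ hC hS h15 L) (SideData.ofDoubleUnderline C μ hC hS hl hp2 hpl hζ hη)
        (t1Space_Huu C) (isClosed_ker_aug_thetaEnvData C μ hC hS) hZ P hP).recon :=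
  prop12_i_indeterminacy_envOfGroup (C.rigidData μ hC hS h15 L)
    (SideData.ofDoubleUnderline C μ hC hS hl hp2 hpl hζ hη) (t1Space_Huu C)
    (isClosed_ker_aug_thetaEnvData C μ hC hS) hZ P hP
    (C.rigidData_cor218_iv_fibre_of_origin μ hC hS h15 L hO hYcl)

/-- Existence form: the Prop. 1.2 (i) output EXISTS for the Tate curve with its indeterminacy clause (same
hypotheses). [claim: Mochizuki2012, status: disputed] (IUTchII §1 Prop 1.2 (i), kurims p.25) -/
theorem exists_envOfGroup_indeterminacy_ofDoubleUnderline
    (h15 : Literature.AnabelianGeometry.EtaleTheta.ThetaSetting.Prop15iii E hC) (L : C.CuspLabels)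
    (hl : l.Prime) (hp2 : p ≠ 2) (hpl : p ≠ l) (hζ : ∃ ζ : D.K, IsPrimitiveRoot ζ (4 * l))
    {η : (C.thetaEnvData μ hC hS).PiYdd → MuN p N} (hη : η ∈ (C.thetaEnvData μ hC hS).thetaCocycles)
    (hZ : Nonempty (ModelCyclotomes.lDeltaQuot (C.rigidData μ hC hS h15 L) ≃* Literature.IUT.HodgeTheaters.ZHat))
    (hO : D.IsEtThOrigin)
    (hYcl : (D.DtpY.map D.toHat.toMonoidHom).topologicalClosure ≤
      D.DtpY.map D.toHat.toMonoidHom ⊔ (⁅⁅D.DeltaHat, D.DeltaHat⁆, D.DeltaHat⁆).topologicalClosure)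
    (P : TopGroup.{0}) (hP : Nonempty (P ≃ₜ* (ofDoubleUnderline C μ hC hS hl hp2 hpl hζ hη).PiX)) :
    ∃ Env : EnvOfGroup (ofDoubleUnderline C μ hC hS hl hp2 hpl hζ hη) P, Prop12_i_indeterminacy Env.recon :=
  ⟨_, prop12_i_indeterminacy_envOfGroup_ofDoubleUnderline C μ hC hS h15 L hl hp2 hpl hζ hη hZ hO hYcl P hP⟩

/-- **[IUTchII] Prop. 1.2 (ii) at the Tate curve** (same inputs): for every instance `Fr` of the typer's interface
`TemperedFrobenioidData` over the [IUTchII] §1 setting `ofDoubleUnderline` and every mono-theta environment `M` of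
it, an `EnvOfFrobenioid Fr` with `M^Θ(𝒞) = M` whose Def. 1.1 (i) output has the Prop. 1.2 (i) indeterminacy —
[EtTh] Cor. 2.18 (iv) supplied by L2's proved chain, `ModelAgreement` by construction (bridge B8 part 2).
[claim: Mochizuki2012, status: disputed] (IUTchII §1 Prop 1.2 (ii), kurims pp.25-26) -/
theorem exists_envOfFrobenioid_indeterminacy_ofDoubleUnderline
    (h15 : Literature.AnabelianGeometry.EtaleTheta.ThetaSetting.Prop15iii E hC) (L : C.CuspLabels)
    (hl : l.Prime) (hp2 : p ≠ 2) (hpl : p ≠ l) (hζ : ∃ ζ : D.K, IsPrimitiveRoot ζ (4 * l))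
    {η : (C.thetaEnvData μ hC hS).PiYdd → MuN p N} (hη : η ∈ (C.thetaEnvData μ hC hS).thetaCocycles)
    (hZ : Nonempty (ModelCyclotomes.lDeltaQuot (C.rigidData μ hC hS h15 L) ≃* Literature.IUT.HodgeTheaters.ZHat))
    (hO : D.IsEtThOrigin)
    (hYcl : (D.DtpY.map D.toHat.toMonoidHom).topologicalClosure ≤
      D.DtpY.map D.toHat.toMonoidHom ⊔ (⁅⁅D.DeltaHat, D.DeltaHat⁆, D.DeltaHat⁆).topologicalClosure)
    (Fr : TemperedFrobenioidData (ofDoubleUnderline C μ hC hS hl hp2 hpl hζ hη))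
    (M : MonoThetaEnv (ofDoubleUnderline C μ hC hS hl hp2 hpl hζ hη)) :
    ∃ Env : EnvOfFrobenioid Fr, Env.env = M ∧ Prop12_i_indeterminacy Env.recon :=
  exists_envOfFrobenioid_indeterminacy
    (modelFrameOfThetaEnvData (C.rigidData μ hC hS h15 L) (SideData.ofDoubleUnderline C μ hC hS hl hp2 hpl hζ hη)
      (t1Space_Huu C) (isClosed_ker_aug_thetaEnvData C μ hC hS) hZ)
    (modelAgreement_ofThetaEnvData (C.rigidData μ hC hS h15 L).toThetaEnvData
      (SideData.ofDoubleUnderline C μ hC hS hl hp2 hpl hζ hη))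
    (C.rigidData_cor218_iv_fibre_of_origin μ hC hS h15 L hO hYcl) Fr M

end Tate

end ThetaSetting

end Literature.IUT.HodgeArakelov
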